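import Literature.Topology.Euclidean.LatticeCubeFaces
import Literature.AlgebraicTopology.Homotopy.ConeFill
import Mathlib.Geometry.Manifold.ChartedSpace
import HarnessLib

/-!
# Relative skeletal extension over a finite lattice cube complex, with parameters and a metric tower

Topic `Literature/AlgebraicTopology/Homotopy`. The generic form of the cell-by-cell extension
device in Hatcher's proof that compact locally contractible subsets of `ℝⁿ` are neighbourhood
retracts (*Algebraic Topology* (2002), Thm. A.7, p. 527: "extend over the cells of a
neighbourhood by induction on dimension, using local contractibility, the cells near `X` being
sent to small sets") and in Milnor's proof that paracompact equi-locally-convex spaces are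
CW-dominated (1959, Lemma 4, p. 279: `q(x) = λ(w, q(y), t)` simplex by simplex), here over a
finite lattice cube complex `LatticeCube.complex 𝒬 h ⊆ ℝᴺ` (`LatticeCubeComplex.lean`,
`LatticeCubeFaces.lean`) with values in a metric space `M` carrying charts into a real normed
space `E`, and with a *parameter* `a ∈ A` carried along (so that the same theorem produces
both a map on the complex and a parametrised homotopy on a prism complex):

* `SkelData N h 𝒬 A M E`: the data — radii `r k`, slack `ρ`, anchor region `Y₀`, charts
  `chart k q` and convex coordinate regions `cvx k q` (the *tower*: level-`k` data within
  `r k + ρ` of an anchor `q` cone in the chart into `closedBall q (r (k+1))`), anchors `p G`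
  of the faces, a boundary-closed set `D` of *prescribed* faces with data `d`, and parameter
  sets `S G` (growing towards boundary faces); `SkelData.Good`: the hypotheses.
* `SkelData.gLevel k`: the stage-`k` map (vertices: prescribed data or the anchor; a
  non-prescribed face of dimension `k + 1` is filled from its boundary by `coneFill` through
  the chart of its anchor, `SkelData.fill`); `faceOf` (the face of `𝒬` through a point).
* `SkelData.exists_extension` (**the theorem**, PROVED by induction on the dimension,
  `SkelData.Inv`): ONE map `g : A → ℝᴺ → M` which for every face `G` of `𝒬` is jointly
  continuous on `S G × G`, equals the prescribed data on prescribed faces, and maps `{a} × G`,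
  `a ∈ S G`, into `closedBall (p G) (r (dim G))`.
* On the way: `continuousOn_prod_iUnion_of_isClosed` (pasting along finitely many closed
  pieces of the second factor).

No named facts; no `sorry`. The two applications (a map `P → M` from vertex data, and a
homotopy on `P × [0, h]` with bottom and top prescribed) are in
`ManifoldCompactFactorization.lean`.

## References

* A. Hatcher, *Algebraic Topology*, CUP (2002), Appendix, proof of Thm. A.7 (p. 527).
  [HatcherAT2002]
* J. Milnor, *On spaces having the homotopy type of a CW-complex*, Trans. AMS 90 (1959),
  proof of Lemma 4 (p. 279). [Milnor1959]
-/

noncomputable section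

open Set Metric Function
open Literature.Topology.Euclidean Literature.Topology.Euclidean.LatticeCube

namespace Literature.AlgebraicTopology.Homotopy

/-! ### A point-set helper -/

section Helpers

variable {A : Type*} [TopologicalSpace A] {X : Type*} [TopologicalSpace X] {Z : Type*}
  [TopologicalSpace Z]

/-- **Pasting along finitely many closed pieces of the second factor**: a function continuous on
each `S ×ˢ Bᵢ`, `Bᵢ` closed, `ι` finite, is continuous on `S ×ˢ ⋃ Bᵢ` (no hypothesis on `S`).
[folklore] -/
theorem continuousOn_prod_iUnion_of_isClosed {ι : Type*} [Finite ι] {f : A × X → Z} {S : Set A}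
    {B : ι → Set X} (hB : ∀ i, IsClosed (B i)) (hf : ∀ i, ContinuousOn f (S ×ˢ B i)) :
    ContinuousOn f (S ×ˢ ⋃ i, B i) := by
  rintro ⟨a, x⟩ ⟨ha, hx⟩
  have key : ∀ i, ContinuousWithinAt f (S ×ˢ B i) (a, x) := by
    intro i
    by_cases hxi : x ∈ B i
    · exact hf i (a, x) ⟨ha, hxi⟩
    · apply continuousWithinAt_of_notMem_closure
      intro hcl
      have : (a, x).2 ∈ closure (B i) := (closure_mono (fun q hq => hq.2) hcl :
        (a, x) ∈ closure (Prod.snd ⁻¹' B i)) |> fun h' => by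
          rw [(hB i).preimage continuous_snd |>.closure_eq] at h'; exact subset_closure h'
      rw [(hB i).closure_eq] at this
      exact hxi this
  rw [ContinuousWithinAt, prod_iUnion, nhdsWithin_iUnion, Filter.tendsto_iSup]
  exact fun i => key i

end Helpers

/-! ### The setting of a skeletal extension -/

section Skeletal

variable {N : ℕ} {h : ℝ} {𝒬 : Finset (Fin N → ℤ)}
  {A : Type*} {M : Type*} [MetricSpace M]
  {E : Type*} [NormedAddCommGroup E] [NormedSpace ℝ E]

/-- The face of `𝒬` in whose relative interior a point of the complex lies (junk off the
complex). [folklore] -/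
def faceOf (𝒬 : Finset (Fin N → ℤ)) (h : ℝ) (y : Fin N → ℝ) : Face N := by
  classical
  exact if hy : ∃ G ∈ faces 𝒬, y ∈ G.relint h then hy.choose else ⟨fun _ => 0, ∅⟩

/-- `faceOf y` is a face of `𝒬` containing `y` in its relative interior, for `y` in the complex.
[folklore] -/
theorem faceOf_spec {y : Fin N → ℝ} (hy : y ∈ complex 𝒬 h) :
    faceOf 𝒬 h y ∈ faces 𝒬 ∧ y ∈ (faceOf 𝒬 h y).relint h := by
  classical
  have hex : ∃ G ∈ faces 𝒬, y ∈ G.relint h := exists_mem_relint_of_mem_complex hy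
  simp only [faceOf, dif_pos hex]
  exact hex.choose_spec

/-- `faceOf` is the unique face of `𝒬` containing `y` in its relative interior (`h > 0`).
[folklore] -/
theorem faceOf_eq_of_mem_relint (hh : 0 < h) {G : Face N} (hG : G ∈ faces 𝒬) {y : Fin N → ℝ}
    (hy : y ∈ G.relint h) : faceOf 𝒬 h y = G := by
  have hyc : y ∈ complex 𝒬 h := carrier_subset_complex hh.le hG (Face.relint_subset_carrier hy)
  exact Face.eq_of_mem_relint hh (faceOf_spec hyc).2 hy

/-- For `y` in a face `G` of `𝒬`, `faceOf y` is `G.relintFace y`, of dimension `≤ dim G`, and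
`< dim G` off the relative interior. [folklore] -/
theorem faceOf_eq_relintFace (hh : 0 < h) {G : Face N} (hG : G ∈ faces 𝒬) {y : Fin N → ℝ}
    (hy : y ∈ G.carrier h) : faceOf 𝒬 h y = G.relintFace h y :=
  faceOf_eq_of_mem_relint hh (relintFace_mem_faces hG y) (Face.mem_relint_relintFace hy)

/-- The dimension of `faceOf y` is at most that of any face containing `y`. [folklore] -/
theorem card_faceOf_le (hh : 0 < h) {G : Face N} (hG : G ∈ faces 𝒬) {y : Fin N → ℝ}
    (hy : y ∈ G.carrier h) : (faceOf 𝒬 h y).S.card ≤ G.S.card := by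
  rw [faceOf_eq_relintFace hh hG hy]; exact Face.card_relintFace_S_le y

/-- The dimension of `faceOf y` is smaller than that of a face containing `y` off its relative
interior. [folklore] -/
theorem card_faceOf_lt (hh : 0 < h) {G : Face N} (hG : G ∈ faces 𝒬) {y : Fin N → ℝ}
    (hy : y ∈ G.carrier h) (hy' : y ∉ G.relint h) : (faceOf 𝒬 h y).S.card < G.S.card := by
  rw [faceOf_eq_relintFace hh hG hy]; exact Face.card_relintFace_S_lt hy hy'

/-- **Skeletal extension data**: the tower of radii `r`, the slack `ρ`, the region `Y₀` of
anchors, the charts `chart k q` and convex coordinate regions `cvx k q` used to fill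
`(k+1)`-faces anchored at `q`, the anchors `p G`, the prescribed faces `D` with data `d` and
the parameter sets `S G`. (A bundle of hypotheses; see `SkelData.Good`.) [folklore] -/
structure SkelData (N : ℕ) (h : ℝ) (𝒬 : Finset (Fin N → ℤ)) (A M E : Type*) [MetricSpace M]
    [NormedAddCommGroup E] [NormedSpace ℝ E] where
  /-- radii of the tower: a `k`-face anchored at `q` is sent into `closedBall q (r k)` -/
  r : ℕ → ℝ
  /-- slack: anchors of a face and of its boundary faces are `ρ`-close -/
  ρ : ℝ
  /-- the region containing all anchors -/
  Y₀ : Set M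
  /-- the chart used to fill a `(k+1)`-face anchored at `q` -/
  chart : ℕ → M → OpenPartialHomeomorph M E
  /-- the convex coordinate region used to fill a `(k+1)`-face anchored at `q` -/
  cvx : ℕ → M → Set E
  /-- anchors -/
  p : Face N → M
  /-- prescribed faces -/
  D : Set (Face N)
  /-- prescribed data (one global function, used on the prescribed faces) -/
  d : A → (Fin N → ℝ) → M
  /-- parameter sets -/
  S : Face N → Set A

variable (X : SkelData N h 𝒬 A M E)

/-! ### The construction -/

/-- Filling a face `G` (of dimension `≥ 1`) from boundary data `g` by coning through the chart
of its anchor. [folklore] -/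
def SkelData.fill (G : Face N) (g : A → (Fin N → ℝ) → M) (a : A) (y : Fin N → ℝ) : M :=
  coneFill (X.chart (G.S.card - 1) (X.p G)) (X.chart (G.S.card - 1) (X.p G)).symm
    (fun _ => X.chart (G.S.card - 1) (X.p G) (X.p G)) (fun a w => g a (G.param h rfl w)) a
    (G.coord h rfl y)

/-- The level-`k` stage of the skeletal extension: the map on (a neighbourhood of) the faces of
dimension `≤ k`. [folklore] -/
def SkelData.gLevel : ℕ → A → (Fin N → ℝ) → M
  | 0, a, y => by
      classical
      exact if (faceOf 𝒬 h y).S.card = 0 ∧ y ∈ complex 𝒬 h then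
        (if faceOf 𝒬 h y ∈ X.D then X.d a y else X.p (faceOf 𝒬 h y)) else X.d a y
  | k + 1, a, y => by
      classical
      exact if (faceOf 𝒬 h y).S.card = k + 1 ∧ y ∈ complex 𝒬 h then
        (if faceOf 𝒬 h y ∈ X.D then X.d a y else X.fill (faceOf 𝒬 h y) (SkelData.gLevel k) a y)
      else SkelData.gLevel k a y

variable {X}

/-- Above the dimension of the face through `y`, the stages no longer change at `y`.
[folklore] -/
theorem SkelData.gLevel_succ_eq {k : ℕ} {y : Fin N → ℝ} (hy : (faceOf 𝒬 h y).S.card ≤ k) (a : A) :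
    X.gLevel (k + 1) a y = X.gLevel k a y := by
  have hne : ¬ ((faceOf 𝒬 h y).S.card = k + 1 ∧ y ∈ complex 𝒬 h) := by
    rintro ⟨h1, -⟩; omega
  simp only [SkelData.gLevel, hne, if_false]

/-- Stages `k ≤ k'` agree at points whose face has dimension `≤ k`. [folklore] -/
theorem SkelData.gLevel_eq_of_le {k k' : ℕ} (hkk' : k ≤ k') {y : Fin N → ℝ}
    (hy : (faceOf 𝒬 h y).S.card ≤ k) (a : A) : X.gLevel k' a y = X.gLevel k a y := by
  induction hkk' with
  | refl => rfl
  | step hle ih => rw [SkelData.gLevel_succ_eq (hy.trans hle), ih]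

/-- The value of stage `k + 1` on the relative interior of a non-prescribed `(k+1)`-face.
[folklore] -/
theorem SkelData.gLevel_succ_of_mem_relint (hh : 0 < h) {k : ℕ} {G : Face N} (hG : G ∈ faces 𝒬)
    (hGk : G.S.card = k + 1) (hGD : G ∉ X.D) {y : Fin N → ℝ} (hy : y ∈ G.relint h) (a : A) :
    X.gLevel (k + 1) a y = X.fill G (X.gLevel k) a y := by
  classical
  have hf : faceOf 𝒬 h y = G := faceOf_eq_of_mem_relint hh hG hy
  have hyc : y ∈ complex 𝒬 h := carrier_subset_complex hh.le hG (Face.relint_subset_carrier hy)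
  simp [SkelData.gLevel, hf, hGk, hyc, hGD]

/-- The value of stage `k + 1` on the relative interior of a prescribed `(k+1)`-face.
[folklore] -/
theorem SkelData.gLevel_succ_of_mem_relint_of_mem_D (hh : 0 < h) {k : ℕ} {G : Face N}
    (hG : G ∈ faces 𝒬) (hGk : G.S.card = k + 1) (hGD : G ∈ X.D) {y : Fin N → ℝ}
    (hy : y ∈ G.relint h) (a : A) : X.gLevel (k + 1) a y = X.d a y := by
  classical
  have hf : faceOf 𝒬 h y = G := faceOf_eq_of_mem_relint hh hG hy
  have hyc : y ∈ complex 𝒬 h := carrier_subset_complex hh.le hG (Face.relint_subset_carrier hy)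
  simp [SkelData.gLevel, hf, hGk, hyc, hGD]

/-- The value of stage `0` at a prescribed vertex. [folklore] -/
theorem SkelData.gLevel_zero_of_vertex_of_mem_D (hh : 0 < h) {G : Face N} (hG : G ∈ faces 𝒬)
    (hG0 : G.S.card = 0) (hGD : G ∈ X.D) (a : A) :
    X.gLevel 0 a (G.cornerPoint h) = X.d a (G.cornerPoint h) := by
  have hS : G.S = ∅ := Finset.card_eq_zero.1 hG0
  have hy : G.cornerPoint h ∈ G.relint h := by
    rw [Face.relint_eq_singleton_of_S_eq_empty hS]; exact mem_singleton _
  have hf : faceOf 𝒬 h (G.cornerPoint h) = G := faceOf_eq_of_mem_relint hh hG hy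
  have hyc : G.cornerPoint h ∈ complex 𝒬 h :=
    carrier_subset_complex hh.le hG (Face.relint_subset_carrier hy)
  simp [SkelData.gLevel, hf, hG0, hyc, hGD]

/-- The value of stage `0` at a non-prescribed vertex: its anchor. [folklore] -/
theorem SkelData.gLevel_zero_of_vertex_of_not_mem_D (hh : 0 < h) {G : Face N} (hG : G ∈ faces 𝒬)
    (hG0 : G.S.card = 0) (hGD : G ∉ X.D) (a : A) :
    X.gLevel 0 a (G.cornerPoint h) = X.p G := by
  have hS : G.S = ∅ := Finset.card_eq_zero.1 hG0
  have hy : G.cornerPoint h ∈ G.relint h := by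
    rw [Face.relint_eq_singleton_of_S_eq_empty hS]; exact mem_singleton _
  have hf : faceOf 𝒬 h (G.cornerPoint h) = G := faceOf_eq_of_mem_relint hh hG hy
  have hyc : G.cornerPoint h ∈ complex 𝒬 h :=
    carrier_subset_complex hh.le hG (Face.relint_subset_carrier hy)
  simp [SkelData.gLevel, hf, hG0, hyc, hGD]

variable [TopologicalSpace A] (X) in
/-- **The hypotheses of the skeletal extension theorem.** [folklore] -/
structure SkelData.Good (X : SkelData N h 𝒬 A M E) : Prop where
  hh : 0 < h
  r_nonneg : ∀ k, 0 ≤ X.r k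
  ρ_nonneg : 0 ≤ X.ρ
  /-- the tower: level-`k` data within `r k + ρ` of an anchor `q` cone, through `chart k q` and
  the convex `cvx k q`, into `closedBall q (r (k+1))` -/
  tower : ∀ k < N, ∀ q ∈ X.Y₀, Convex ℝ (X.cvx k q) ∧ closedBall q (X.r k + X.ρ) ⊆ (X.chart k q).source ∧
    X.chart k q '' closedBall q (X.r k + X.ρ) ⊆ X.cvx k q ∧ X.cvx k q ⊆ (X.chart k q).target ∧
    (X.chart k q).symm '' X.cvx k q ⊆ closedBall q (X.r (k + 1))
  anchor_mem : ∀ G ∈ faces 𝒬, X.p G ∈ X.Y₀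
  anchor_close : ∀ G ∈ faces 𝒬, ∀ i ∈ G.S, ∀ up : Bool, dist (X.p (G.bdFace i up)) (X.p G) ≤ X.ρ
  D_closed : ∀ G ∈ X.D, ∀ i ∈ G.S, ∀ up : Bool, G.bdFace i up ∈ X.D
  S_anti : ∀ G : Face N, ∀ i ∈ G.S, ∀ up : Bool, X.S G ⊆ X.S (G.bdFace i up)
  d_cont : ∀ G ∈ faces 𝒬, G ∈ X.D →
    ContinuousOn (fun q : A × (Fin N → ℝ) => X.d q.1 q.2) (X.S G ×ˢ G.carrier h)
  d_mem : ∀ G ∈ faces 𝒬, G ∈ X.D → ∀ a ∈ X.S G, ∀ y ∈ G.carrier h,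
    X.d a y ∈ closedBall (X.p G) (X.r G.S.card)

variable [TopologicalSpace A]

/-! ### The invariants -/

/-- The invariants of stage `k` on the faces of dimension `≤ k`: continuity on
`S G × carrier G`, agreement with the prescribed data on prescribed faces, and the tower bound.
[folklore] -/
structure SkelData.Inv (X : SkelData N h 𝒬 A M E) (k : ℕ) : Prop where
  cont : ∀ G ∈ faces 𝒬, G.S.card ≤ k →
    ContinuousOn (fun q : A × (Fin N → ℝ) => X.gLevel k q.1 q.2) (X.S G ×ˢ G.carrier h)
  presc : ∀ G ∈ faces 𝒬, G.S.card ≤ k → G ∈ X.D → ∀ a, ∀ y ∈ G.carrier h, X.gLevel k a y = X.d a y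
  mem : ∀ G ∈ faces 𝒬, G.S.card ≤ k → ∀ a ∈ X.S G, ∀ y ∈ G.carrier h,
    X.gLevel k a y ∈ closedBall (X.p G) (X.r G.S.card)

/-- **Base case**: the invariants hold at stage `0`. [folklore] -/
theorem SkelData.inv_zero (hX : X.Good) : X.Inv 0 := by
  have hh := hX.hh
  have key : ∀ G ∈ faces 𝒬, G.S.card ≤ 0 → G.S = ∅ ∧ G.S.card = 0 := fun G _ hG0 =>
    ⟨Finset.card_eq_zero.1 (Nat.le_zero.1 hG0), Nat.le_zero.1 hG0⟩
  refine ⟨fun G hG hG0 => ?_, fun G hG hG0 hGD a y hy => ?_, fun G hG hG0 a ha y hy => ?_⟩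
  · obtain ⟨hS, hc⟩ := key G hG hG0
    rw [Face.carrier_eq_singleton_of_S_eq_empty hS]
    by_cases hGD : G ∈ X.D
    · refine (hX.d_cont G hG hGD).mono ?_ |>.congr fun q hq => ?_
      · rw [Face.carrier_eq_singleton_of_S_eq_empty hS]
      · obtain ⟨-, hq2⟩ := hq
        rw [mem_singleton_iff] at hq2
        simp only
        rw [hq2, SkelData.gLevel_zero_of_vertex_of_mem_D hh hG hc hGD]
    · refine (continuousOn_const (c := X.p G)).congr fun q hq => ?_
      obtain ⟨-, hq2⟩ := hq
      rw [mem_singleton_iff] at hq2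
      simp only
      rw [hq2, SkelData.gLevel_zero_of_vertex_of_not_mem_D hh hG hc hGD]
  · obtain ⟨hS, hc⟩ := key G hG hG0
    rw [Face.carrier_eq_singleton_of_S_eq_empty hS, mem_singleton_iff] at hy
    rw [hy, SkelData.gLevel_zero_of_vertex_of_mem_D hh hG hc hGD]
  · obtain ⟨hS, hc⟩ := key G hG hG0
    rw [Face.carrier_eq_singleton_of_S_eq_empty hS, mem_singleton_iff] at hy
    rw [hy, hc]
    by_cases hGD : G ∈ X.D
    · rw [SkelData.gLevel_zero_of_vertex_of_mem_D hh hG hc hGD]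
      have := hX.d_mem G hG hGD a ha _ (Face.cornerPoint_mem_carrier hh.le)
      rwa [hc] at this
    · rw [SkelData.gLevel_zero_of_vertex_of_not_mem_D hh hG hc hGD]
      exact mem_closedBall_self (hX.r_nonneg 0)

/-- The boundary of a face of `𝒬`: the union of its boundary faces, as an indexed union over
`(i, up)`. [folklore] -/
theorem iUnion_bdFace_eq (hh : 0 < h) (G : Face N) :
    (⋃ q : ↥G.S × Bool, (G.bdFace (q.1 : Fin N) q.2).carrier h) = G.carrier h \ G.relint h := by
  apply Subset.antisymm
  · rintro y hy
    obtain ⟨⟨i, up⟩, hy⟩ := mem_iUnion.1 hy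
    exact ⟨Face.carrier_bdFace_subset hh.le i.2 up hy, Face.not_mem_relint_of_mem_carrier_bdFace i.2 up hy⟩
  · rintro y ⟨hy, hy'⟩
    obtain ⟨i, hi, up, hyi⟩ := Face.exists_mem_carrier_bdFace hy hy'
    exact mem_iUnion.2 ⟨(⟨i, hi⟩, up), hyi⟩

/-- **Continuity of a stage on the boundary of a face of the next dimension**, assembled from
its continuity on the (finitely many, closed) boundary faces. [folklore] -/
theorem SkelData.continuousOn_boundary (hX : X.Good) {k : ℕ} (hI : X.Inv k) {G : Face N}
    (hG : G ∈ faces 𝒬) (hGk : G.S.card = k + 1) :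
    ContinuousOn (fun q : A × (Fin N → ℝ) => X.gLevel k q.1 q.2) (X.S G ×ˢ (G.carrier h \ G.relint h)) := by
  rw [← iUnion_bdFace_eq hX.hh G]
  refine continuousOn_prod_iUnion_of_isClosed (fun q => ?_) fun q => ?_
  · -- closed boundary faces: compact top cubes are closed; a face is closed as a preimage
    have : (G.bdFace (q.1 : Fin N) q.2).carrier h =
        ⋂ i, {y : Fin N → ℝ | (i ∈ (G.bdFace (q.1 : Fin N) q.2).S →
          ((G.bdFace (q.1 : Fin N) q.2).a i : ℝ) * h ≤ y i ∧ y i ≤ (((G.bdFace (q.1 : Fin N) q.2).a i : ℝ) + 1) * h) ∧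
          (i ∉ (G.bdFace (q.1 : Fin N) q.2).S → y i = ((G.bdFace (q.1 : Fin N) q.2).a i : ℝ) * h)} := by
      ext y; simp [Face.mem_carrier]
    rw [this]
    refine isClosed_iInter fun i => ?_
    by_cases hi : i ∈ (G.bdFace (q.1 : Fin N) q.2).S
    · simp only [hi, true_implies, not_true_eq_false, false_implies, and_true]
      exact (isClosed_le continuous_const (continuous_apply i)).inter
        (isClosed_le (continuous_apply i) continuous_const)
    · simp only [hi, false_implies, not_false_eq_true, true_implies, true_and]
      exact isClosed_eq (continuous_apply i) continuous_const
  · have hq := bdFace_mem_faces hG q.1.2 q.2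
    have hqk : (G.bdFace (q.1 : Fin N) q.2).S.card ≤ k := by
      rw [Face.card_bdFace_S q.1.2, hGk]; omega
    exact (hI.cont _ hq hqk).mono (prod_mono (hX.S_anti G q.1 q.1.2 q.2) Subset.rfl)

/-- On the boundary of a `(k+1)`-face, stage `k` takes values in the `(r k + ρ)`-ball of the
anchor. [folklore] -/
theorem SkelData.mem_closedBall_of_boundary (hX : X.Good) {k : ℕ} (hI : X.Inv k) {G : Face N}
    (hG : G ∈ faces 𝒬) (hGk : G.S.card = k + 1) {a : A} (ha : a ∈ X.S G) {y : Fin N → ℝ}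
    (hy : y ∈ G.carrier h) (hy' : y ∉ G.relint h) :
    X.gLevel k a y ∈ closedBall (X.p G) (X.r k + X.ρ) := by
  obtain ⟨i, hi, up, hyi⟩ := Face.exists_mem_carrier_bdFace hy hy'
  have hq := bdFace_mem_faces hG hi up
  have hqk : (G.bdFace i up).S.card = k := by rw [Face.card_bdFace_S hi, hGk]; omega
  have h1 := hI.mem _ hq hqk.le a (hX.S_anti G i hi up ha) y hyi
  rw [hqk] at h1
  rw [mem_closedBall] at h1 ⊢
  linarith [dist_triangle (X.gLevel k a y) (X.p (G.bdFace i up)) (X.p G), hX.anchor_close G hG i hi up]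

/-- **Inductive step**: the invariants propagate from stage `k` to stage `k + 1` (`k < N`; for
`k ≥ N` there are no faces of dimension `k + 1` and the stages agree on all faces). [folklore] -/
theorem SkelData.inv_succ (hX : X.Good) {k : ℕ} (hI : X.Inv k) : X.Inv (k + 1) := by
  have hh := hX.hh
  -- agreement with the previous stage on faces of dimension `≤ k`
  have hagree : ∀ G ∈ faces 𝒬, G.S.card ≤ k → ∀ a, ∀ y ∈ G.carrier h,
      X.gLevel (k + 1) a y = X.gLevel k a y := fun G hG hGk a y hy =>
    SkelData.gLevel_succ_eq ((card_faceOf_le hh hG hy).trans hGk) a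
  -- agreement on the boundary of a `(k+1)`-face
  have hbd : ∀ G ∈ faces 𝒬, G.S.card = k + 1 → ∀ a, ∀ y ∈ G.carrier h, y ∉ G.relint h →
      X.gLevel (k + 1) a y = X.gLevel k a y := fun G hG hGk a y hy hy' =>
    SkelData.gLevel_succ_eq (by have := card_faceOf_lt hh hG hy hy'; omega) a
  -- the prescribed `(k+1)`-faces
  have hpresc : ∀ G ∈ faces 𝒬, G.S.card = k + 1 → G ∈ X.D → ∀ a, ∀ y ∈ G.carrier h,
      X.gLevel (k + 1) a y = X.d a y := by
    intro G hG hGk hGD a y hy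
    by_cases hy' : y ∈ G.relint h
    · exact SkelData.gLevel_succ_of_mem_relint_of_mem_D hh hG hGk hGD hy' a
    · rw [hbd G hG hGk a y hy hy']
      obtain ⟨i, hi, up, hyi⟩ := Face.exists_mem_carrier_bdFace hy hy'
      exact hI.presc _ (bdFace_mem_faces hG hi up) (by rw [Face.card_bdFace_S hi, hGk]; omega)
        (hX.D_closed G hGD i hi up) a y hyi
  -- the filled `(k+1)`-faces: set-up of the cone filling
  have hfill : ∀ G ∈ faces 𝒬, G.S.card = k + 1 → G ∉ X.D →
      (∀ a ∈ X.S G, ∀ y ∈ G.carrier h, X.gLevel (k + 1) a y = X.fill G (X.gLevel k) a y) ∧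
      ContinuousOn (fun q : A × (Fin N → ℝ) => X.fill G (X.gLevel k) q.1 q.2) (X.S G ×ˢ G.carrier h) ∧
      (∀ a ∈ X.S G, ∀ y ∈ G.carrier h, X.fill G (X.gLevel k) a y ∈ closedBall (X.p G) (X.r (k + 1))) := by
    intro G hG hGk hGD
    have hkN : k < N := by have := card_S_le G; omega
    obtain ⟨hcvx, hsrc, himg, htgt, hback⟩ := hX.tower k hkN (X.p G) (hX.anchor_mem G hG)
    set e := X.chart k (X.p G) with he
    have hk1 : G.S.card - 1 = k := by omega
    have hfill_def : ∀ a y, X.fill G (X.gLevel k) a y = coneFill e e.symm (fun _ => e (X.p G))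
        (fun a w => X.gLevel k a (G.param h rfl w)) a (G.coord h rfl y) := by
      intro a y; simp only [SkelData.fill, hk1, he]
    -- boundary values lie in the source of the chart
    have hsrc' : ∀ a ∈ X.S G, ∀ y ∈ G.carrier h, y ∉ G.relint h → X.gLevel k a y ∈ e.source :=
      fun a ha y hy hy' => hsrc (SkelData.mem_closedBall_of_boundary hX hI hG hGk ha hy hy')
    have hpc : X.p G ∈ closedBall (X.p G) (X.r k + X.ρ) :=
      mem_closedBall_self (add_nonneg (hX.r_nonneg k) hX.ρ_nonneg)
    -- the boundary sphere is sent to the boundary of the face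
    have hsph : ∀ w ∈ sphere (0 : Fin G.S.card → ℝ) 1,
        G.param h rfl w ∈ G.carrier h ∧ G.param h rfl w ∉ G.relint h := by
      intro w hw
      obtain ⟨i, hi, up, hwi⟩ := Face.param_mem_carrier_bdFace_of_mem_sphere hh rfl hw
      exact ⟨Face.carrier_bdFace_subset hh.le hi up hwi, Face.not_mem_relint_of_mem_carrier_bdFace hi up hwi⟩
    refine ⟨fun a ha y hy => ?_, ?_, fun a ha y hy => ?_⟩
    · -- stage `k+1` is the filling on the whole face
      by_cases hy' : y ∈ G.relint h
      · exact SkelData.gLevel_succ_of_mem_relint hh hG hGk hGD hy' a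
      · rw [hbd G hG hGk a y hy hy', hfill_def]
        have hn : ‖G.coord h rfl y‖ = 1 := Face.norm_coord_eq_one_of_not_mem_relint hh rfl hy hy'
        rw [coneFill_of_norm_eq_one _ _ _ _ a hn]
        · rw [Face.param_coord hh hy]
        · rw [Face.param_coord hh hy]
          exact e.left_inv (hsrc' a ha y hy hy')
    · -- continuity of the filling
      have hcone : ContinuousOn (fun q : A × (Fin G.S.card → ℝ) =>
          coneFill e e.symm (fun _ => e (X.p G)) (fun a w => X.gLevel k a (G.param h rfl w)) q.1 q.2)
          (X.S G ×ˢ closedBall 0 1) := by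
        refine continuousOn_coneFill _ _ _ _ (S := X.S G) (V := e.source) (T := e.target)
          continuousOn_const ?_ ?_ e.continuousOn e.continuousOn_symm (fun a _ => e.map_source (hsrc hpc)) ?_
        · refine (SkelData.continuousOn_boundary hX hI hG hGk).comp
            (continuous_fst.prodMk (Face.continuous_param.comp continuous_snd)).continuousOn ?_
          rintro ⟨a, w⟩ ⟨ha, hw⟩
          exact ⟨ha, hsph w hw⟩
        · rintro a ha w hw
          exact hsrc' a ha _ (hsph w hw).1 (hsph w hw).2
        · intro a ha w hw s hs
          apply htgt
          have h1 : e (X.p G) ∈ X.cvx k (X.p G) := himg ⟨_, hpc, rfl⟩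
          have h2 : e (X.gLevel k a (G.param h rfl w)) ∈ X.cvx k (X.p G) :=
            himg ⟨_, SkelData.mem_closedBall_of_boundary hX hI hG hGk ha (hsph w hw).1 (hsph w hw).2, rfl⟩
          have := hcvx.segment_subset h1 h2
          apply this
          rw [segment_eq_image']
          exact ⟨s, hs, rfl⟩
      have hco : ContinuousOn (fun q : A × (Fin N → ℝ) => (q.1, G.coord h (rfl : G.S.card = G.S.card) q.2))
          (X.S G ×ˢ G.carrier h) :=
        (continuous_fst.prodMk (Face.continuous_coord.comp continuous_snd)).continuousOn
      refine (hcone.comp hco ?_).congr fun q _ => hfill_def q.1 q.2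
      rintro ⟨a, y⟩ ⟨ha, hy⟩
      exact ⟨ha, Face.coord_mem_closedBall hh hy⟩
    · -- the tower bound
      rw [hfill_def]
      refine hback ?_
      refine coneFill_mem_image_of_convex _ _ _ _ a hcvx (himg ⟨_, hpc, rfl⟩) (fun v hv => ?_)
        (mem_closedBall_zero_iff.1 (Face.coord_mem_closedBall hh hy))
      exact himg ⟨_, SkelData.mem_closedBall_of_boundary hX hI hG hGk ha (hsph v hv).1 (hsph v hv).2, rfl⟩
  -- assemble
  refine ⟨fun G hG hGk => ?_, fun G hG hGk hGD a y hy => ?_, fun G hG hGk a ha y hy => ?_⟩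
  · rcases hGk.lt_or_eq with hlt | heq
    · exact (hI.cont G hG (by omega)).congr fun q hq => hagree G hG (by omega) q.1 q.2 hq.2
    · by_cases hGD : G ∈ X.D
      · exact (hX.d_cont G hG hGD).congr fun q hq => hpresc G hG heq hGD q.1 q.2 hq.2
      · obtain ⟨heq', hcont, -⟩ := hfill G hG heq hGD
        exact hcont.congr fun q hq => heq' q.1 hq.1 q.2 hq.2
  · rcases hGk.lt_or_eq with hlt | heq
    · rw [hagree G hG (by omega) a y hy]; exact hI.presc G hG (by omega) hGD a y hy
    · exact hpresc G hG heq hGD a y hy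
  · rcases hGk.lt_or_eq with hlt | heq
    · rw [hagree G hG (by omega) a y hy]; exact hI.mem G hG (by omega) a ha y hy
    · by_cases hGD : G ∈ X.D
      · rw [hpresc G hG heq hGD a y hy]; exact hX.d_mem G hG hGD a ha y hy
      · obtain ⟨heq', -, hmem⟩ := hfill G hG heq hGD
        rw [heq' a ha y hy, heq]; exact hmem a ha y hy

/-- The invariants hold at every stage. [folklore] -/
theorem SkelData.inv (hX : X.Good) (k : ℕ) : X.Inv k := by
  induction k with
  | zero => exact SkelData.inv_zero hX
  | succ k ih => exact SkelData.inv_succ hX ih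

/-- **Relative skeletal extension over a finite lattice cube complex, with parameters and a
metric tower** (the device of Hatcher, *Algebraic Topology* (2002), proof of Thm. A.7, p. 527 —
"extend over the cells of a neighbourhood by induction on dimension, using local
contractibility" — and of Milnor 1959, proof of Lemma 4, p. 279). Given `SkelData` `X` with
`X.Good`: radii `r k`, slack `ρ`, charts `chart k q` with convex coordinate regions `cvx k q`
realising the tower at every anchor `q ∈ Y₀`, anchors `p G ∈ Y₀` of the faces of `𝒬` that are
`ρ`-close along boundary faces, a boundary-closed set `D` of prescribed faces with data `d`
continuous on `S G × G` and within `r (dim G)` of the anchor, and parameter sets `S G` growing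
towards the boundary — there is ONE map `g : A → ℝᴺ → M` which, for every face `G` of `𝒬`, is
jointly continuous on `S G × G`, equals `d` on the prescribed faces, and sends `{a} × G`,
`a ∈ S G`, into `closedBall (p G) (r (dim G))`. PROVED (`SkelData.gLevel N`, invariants by
induction on the dimension). [cite: HatcherAT2002, Thm. A.7 (proof, p. 527)] -/
theorem SkelData.exists_extension (hX : X.Good) :
    ∃ g : A → (Fin N → ℝ) → M,
      (∀ G ∈ faces 𝒬, ContinuousOn (fun q : A × (Fin N → ℝ) => g q.1 q.2) (X.S G ×ˢ G.carrier h)) ∧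
      (∀ G ∈ faces 𝒬, G ∈ X.D → ∀ a, ∀ y ∈ G.carrier h, g a y = X.d a y) ∧
      (∀ G ∈ faces 𝒬, ∀ a ∈ X.S G, ∀ y ∈ G.carrier h, g a y ∈ closedBall (X.p G) (X.r G.S.card)) := by
  have hI := SkelData.inv hX N
  exact ⟨X.gLevel N, fun G hG => hI.cont G hG (card_S_le G),
    fun G hG hGD a y hy => hI.presc G hG (card_S_le G) hGD a y hy,
    fun G hG a ha y hy => hI.mem G hG (card_S_le G) a ha y hy⟩

end Skeletal

end Literature.AlgebraicTopology.Homotopy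

end
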